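import Summits.QuantumFields.YangMills.Theorems.ForcedResponseSkewnessResponseLocalisationSmearedDefs
import Summits.QuantumFields.YangMills.Theorems.ForcedResponseSkewnessResponseLocalisationContactOfFemto
import HarnessLib

/-!
# Route `ForcedResponseSkewness`, crux `ResponseLocalisation` (stmt-QuantumFields-24869), line «smeared-femto»:
# toolkit for the collar transfer with a SMEARED near observable

Helpers of the registered analysis stub `stub_smearedKernelOfFemto : SmearedKernelOfFemtoSigR` (lead `ym-line-frs-p1` g4;
`--supports stmt-QuantumFields-24869`).  The transfer of `contactKernel_of_femto` (p606368) is redone with the near observable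
`A₂ = (dens x − m_x) · Σ_{z ∈ S} w_z (dens z − m_z)` — the near partner smeared against lattice weights `w_z` (in the stub:
`w_z = w((l·a β)·z)` for a Schwartz `w`) — instead of the sharp pair `(dens x − m_x)(dens z − m_z)`:

* `kerE_sum_mul` — kernel means are linear over finite weighted sums of bounded continuous observables;
* `kerE_smeared_centred` — the kernel mean of `A₂` is `Σ_z w_z (kerCov_η(dens x, dens z) + (γ_η dens x − m_x)(γ_η dens z − m_z))`;
* `torusE_sum_mul`, `sum_mul_torusK3_eq_integral_smeared` — on the torus, `Σ_z w_z κ₃^T(x,y,z) = ⟨(dens y − ⟨dens y⟩)(A₂ − ⟨A₂⟩)⟩`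
  (linearity over `torusK3_eq_integral_centred`);
* `near_site_facts` — for a site `z₁ + w` of the radius-`M+1` cube around `z₁` with `|w_j| ≤ N`, `2N ≤ M`, `4 ≤ M`: it is a cylinder
  observable of the cube, has depth `≥ M/2`, its kernel means are within `16C₁/M⁴` of the FBL reference and its torus mean likewise.

No summit is proved by any of this (leaf R2a `BalabanLadder.NT`, conditional rung line; the YM mass gap is NOT proved).
Refs: Georgii, Gibbs Measures and Phase Transitions (2011) Thm. 4.17 (conditional independence of separated volumes).
-/

set_option autoImplicit false

noncomputable section

namespace Summit.QuantumFields.YangMills.Cruxes.ResponseLocalisation.Smeared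

open MeasureTheory Filter Topology
open Literature.MathematicalPhysics.QuantumFieldTheory Literature.MathematicalPhysics.QuantumLattice
open Literature.Probability.LatticeModels
open Summit.QuantumFields.YangMills.Cruxes.OSLegsFromFemtoAndGap.DlrCollarTransfer
open Summit.QuantumFields.YangMills.Cruxes.RunningCouplingCeiling.Pointwise (torusDist)
open Summit.QuantumFields.YangMills.Cruxes.ResponseLocalisation.Birth
open Summit.QuantumFields.YangMills.Cruxes.ResponseLocalisation.Femto

/-! ## §1 Linearity of kernel and torus means over weighted finite sums -/

section Linear

variable {G : Type} [Group G] [TopologicalSpace G] [IsTopologicalGroup G] [CompactSpace G]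
  [MeasurableSpace G] [BorelSpace G] [SecondCountableTopology G] (r : LatticeRep G)

/-- Kernel means are linear over finite weighted sums of bounded continuous observables. [folklore] -/
theorem kerE_sum_mul (β : ℝ) (c : Fin 4 → ℤ) (b : ℕ) (η : LGConfig 4 G) (S : Finset (Fin 4 → ℤ))
    (wt : (Fin 4 → ℤ) → ℝ) {F : (Fin 4 → ℤ) → LGConfig 4 G → ℝ} (hc : ∀ z, Continuous (F z))
    {B : (Fin 4 → ℤ) → ℝ} (hb : ∀ z U, |F z U| ≤ B z) :
    kerE G r β c b η (fun U => ∑ z ∈ S, wt z * F z U) = ∑ z ∈ S, wt z * kerE G r β c b η (F z) := by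
  unfold kerE
  haveI := isProbabilityMeasure_ymSpecification r.ρ r.continuous β (cubeEdges c b) η
  have hint : ∀ z ∈ S, Integrable (fun U => wt z * F z U) (ymSpecification (d := 4) r.ρ β (cubeEdges c b) η) := by
    intro z _
    refine integrable_of_abs_le ((hc z).measurable.const_mul (wt z)) (C := |wt z| * B z) fun U => ?_
    rw [abs_mul]
    exact mul_le_mul_of_nonneg_left (hb z U) (abs_nonneg _)
  rw [integral_finsetSum S hint]
  refine Finset.sum_congr rfl fun z _ => ?_
  exact integral_const_mul (wt z) (F z)

/-- Torus means are linear over finite weighted sums of bounded continuous observables. [folklore] -/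
theorem torusE_sum_mul (β : ℝ) (L : ℕ) (S : Finset (Fin 4 → ℤ)) (wt : (Fin 4 → ℤ) → ℝ)
    {F : (Fin 4 → ℤ) → LGConfig 4 G → ℝ} (hc : ∀ z, Continuous (F z)) {B : (Fin 4 → ℤ) → ℝ} (hb : ∀ z U, |F z U| ≤ B z) :
    torusE G r β L (fun U => ∑ z ∈ S, wt z * F z U) = ∑ z ∈ S, wt z * torusE G r β L (F z) := by
  unfold torusE
  haveI : NeZero (2 * L + 1) := ⟨by omega⟩
  haveI := isProbabilityMeasure_wilsonMeasure (d := 4) (L := 2 * L + 1) r.ρ r.continuous β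
  have hint : ∀ z ∈ S, Integrable (fun V : GaugeConfig 4 (2 * L + 1) G => wt z * F z (torusLift (2 * L + 1) V))
      (wilsonMeasure (d := 4) (L := 2 * L + 1) r.ρ β) := by
    intro z _
    refine integrable_of_abs_le (((hc z).comp (continuous_torusLift (2 * L + 1))).measurable.const_mul (wt z))
      (C := |wt z| * B z) fun V => ?_
    rw [abs_mul]
    exact mul_le_mul_of_nonneg_left (hb z _) (abs_nonneg _)
  rw [integral_finsetSum S hint]
  refine Finset.sum_congr rfl fun z _ => ?_
  exact integral_const_mul (wt z) _

omit [SecondCountableTopology G] in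
/-- The smeared near observable, expanded as a weighted sum of sharp centred pairs. [folklore] -/
theorem smeared_eq_sum (x : Fin 4 → ℤ) (S : Finset (Fin 4 → ℤ)) (wt : (Fin 4 → ℤ) → ℝ) (mx : ℝ) (m : (Fin 4 → ℤ) → ℝ) :
    (fun U : LGConfig 4 G => (dens G r x U - mx) * ∑ z ∈ S, wt z * (dens G r z U - m z)) =
      fun U => ∑ z ∈ S, wt z * ((dens G r x U - mx) * (dens G r z U - m z)) := by
  funext U
  rw [Finset.mul_sum]
  refine Finset.sum_congr rfl fun z _ => ?_
  ring

omit [SecondCountableTopology G] in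
/-- A sharp centred pair is bounded. [folklore] -/
theorem abs_centred_pair_le {CA : ℝ} (hCA : ∀ (x : Fin 4 → ℤ) (U : LGConfig 4 G), |dens G r x U| ≤ CA)
    (x z : Fin 4 → ℤ) (mx mz : ℝ) (U : LGConfig 4 G) :
    |(dens G r x U - mx) * (dens G r z U - mz)| ≤ (CA + |mx|) * (CA + |mz|) := by
  rw [abs_mul]
  have h1 : |dens G r x U - mx| ≤ CA + |mx| := (abs_sub _ _).trans (add_le_add (hCA _ _) le_rfl)
  have h2 : |dens G r z U - mz| ≤ CA + |mz| := (abs_sub _ _).trans (add_le_add (hCA _ _) le_rfl)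
  exact mul_le_mul h1 h2 (abs_nonneg _) ((abs_nonneg _).trans h1)

/-- **Kernel mean of the smeared near observable**:
`γ_η((dens x − m_x)·Σ_z w_z(dens z − m_z)) = Σ_z w_z (kerCov_η(dens x, dens z) + (γ_η dens x − m_x)(γ_η dens z − m_z))`. [folklore] -/
theorem kerE_smeared_centred (β : ℝ) (c : Fin 4 → ℤ) (b : ℕ) (η : LGConfig 4 G) (x : Fin 4 → ℤ) (S : Finset (Fin 4 → ℤ))
    (wt : (Fin 4 → ℤ) → ℝ) (mx : ℝ) (m : (Fin 4 → ℤ) → ℝ) :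
    kerE G r β c b η (fun U => (dens G r x U - mx) * ∑ z ∈ S, wt z * (dens G r z U - m z)) =
      ∑ z ∈ S, wt z * (kerCov G r β c b η (dens G r x) (dens G r z) +
        (kerE G r β c b η (dens G r x) - mx) * (kerE G r β c b η (dens G r z) - m z)) := by
  obtain ⟨CA, hCA⟩ := r.curvature.bounded
  have hCA' : ∀ (u : Fin 4 → ℤ) (U : LGConfig 4 G), |dens G r u U| ≤ CA := fun u U => hCA _
  rw [smeared_eq_sum r x S wt mx m,
    kerE_sum_mul r β c b η S wt (F := fun z U => (dens G r x U - mx) * (dens G r z U - m z))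
      (fun z => ((continuous_dens r x).sub continuous_const).mul ((continuous_dens r z).sub continuous_const))
      (B := fun z => (CA + |mx|) * (CA + |m z|)) (fun z U => abs_centred_pair_le r hCA' x z mx (m z) U)]
  refine Finset.sum_congr rfl fun z _ => ?_
  rw [kerE_centred_mul r β c b η (continuous_dens r x) (continuous_dens r z) (fun U => hCA _) (fun U => hCA _) mx (m z)]

/-- **The smeared third cumulant as a two-observable centred moment**: with the smeared near observable
`A₂ = (dens x − ⟨dens x⟩)·Σ_z w_z (dens z − ⟨dens z⟩)`, `Σ_z w_z κ₃^T(x,y,z) = ⟨(dens y − ⟨dens y⟩)(A₂ − ⟨A₂⟩)⟩`. [folklore] -/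
theorem sum_mul_torusK3_eq_integral_smeared (β : ℝ) (L : ℕ) (x y : Fin 4 → ℤ) (S : Finset (Fin 4 → ℤ))
    (wt : (Fin 4 → ℤ) → ℝ) (mx : ℝ) (m : (Fin 4 → ℤ) → ℝ)
    (hmx : mx = torusE G r β L (dens G r x)) (hm : ∀ z ∈ S, m z = torusE G r β L (dens G r z)) :
    ∑ z ∈ S, wt z * torusK3 G r β L x y z =
      ∫ V, (dens G r y (torusLift (2 * L + 1) V) - ∫ V', dens G r y (torusLift (2 * L + 1) V') ∂(wilsonMeasure r.ρ β)) *
        ((fun U => (dens G r x U - mx) * ∑ z ∈ S, wt z * (dens G r z U - m z)) (torusLift (2 * L + 1) V) -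
          ∫ V', (fun U => (dens G r x U - mx) * ∑ z ∈ S, wt z * (dens G r z U - m z)) (torusLift (2 * L + 1) V')
            ∂(wilsonMeasure r.ρ β)) ∂(wilsonMeasure r.ρ β) := by
  classical
  obtain ⟨CA, hCA⟩ := r.curvature.bounded
  have hCA' : ∀ (u : Fin 4 → ℤ) (U : LGConfig 4 G), |dens G r u U| ≤ CA := fun u U => hCA _
  haveI : NeZero (2 * L + 1) := ⟨by omega⟩
  haveI := isProbabilityMeasure_wilsonMeasure (d := 4) (L := 2 * L + 1) r.ρ r.continuous β
  set P := wilsonMeasure (d := 4) (L := 2 * L + 1) r.ρ β with hP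
  -- the sharp centred pairs and the centred far density
  set W : (Fin 4 → ℤ) → LGConfig 4 G → ℝ := fun z U => (dens G r x U - mx) * (dens G r z U - m z) with hW
  set Yc : GaugeConfig 4 (2 * L + 1) G → ℝ :=
    fun V => dens G r y (torusLift (2 * L + 1) V) - ∫ V', dens G r y (torusLift (2 * L + 1) V') ∂P with hYc
  have hWc : ∀ z, Continuous (W z) := fun z =>
    ((continuous_dens r x).sub continuous_const).mul ((continuous_dens r z).sub continuous_const)
  have hWb : ∀ z U, |W z U| ≤ (CA + |mx|) * (CA + |m z|) := fun z U => abs_centred_pair_le r hCA' x z mx (m z) U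
  have hYm : Measurable Yc := (((continuous_dens r y).comp (continuous_torusLift (2 * L + 1))).sub continuous_const).measurable
  have hYb : ∀ V, |Yc V| ≤ CA + |∫ V', dens G r y (torusLift (2 * L + 1) V') ∂P| := fun V =>
    (abs_sub _ _).trans (add_le_add (hCA _) le_rfl)
  -- per site: `κ₃ = ⟨Yc (W_z − ⟨W_z⟩)⟩`
  have hz : ∀ z ∈ S, torusK3 G r β L x y z = ∫ V, Yc V * (W z (torusLift (2 * L + 1) V) - ∫ V', W z (torusLift (2 * L + 1) V') ∂P) ∂P :=
    fun z hz => torusK3_eq_integral_centred r β L x y z mx (m z) hmx (hm z hz)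
  -- integrability of each summand
  have hint : ∀ z ∈ S, Integrable
      (fun V => wt z * (Yc V * (W z (torusLift (2 * L + 1) V) - ∫ V', W z (torusLift (2 * L + 1) V') ∂P))) P := by
    intro z _
    have hm1 : Measurable fun V => W z (torusLift (2 * L + 1) V) - ∫ V', W z (torusLift (2 * L + 1) V') ∂P :=
      (((hWc z).comp (continuous_torusLift (2 * L + 1))).sub continuous_const).measurable
    refine integrable_of_abs_le ((hYm.mul hm1).const_mul (wt z))
      (C := |wt z| * ((CA + |∫ V', dens G r y (torusLift (2 * L + 1) V') ∂P|) *
        ((CA + |mx|) * (CA + |m z|) + |∫ V', W z (torusLift (2 * L + 1) V') ∂P|))) fun V => ?_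
    rw [abs_mul, abs_mul]
    refine mul_le_mul_of_nonneg_left ?_ (abs_nonneg _)
    have h2 : |W z (torusLift (2 * L + 1) V) - ∫ V', W z (torusLift (2 * L + 1) V') ∂P| ≤
        (CA + |mx|) * (CA + |m z|) + |∫ V', W z (torusLift (2 * L + 1) V') ∂P| :=
      (abs_sub _ _).trans (add_le_add (hWb z _) le_rfl)
    exact mul_le_mul (hYb V) h2 (abs_nonneg _) ((abs_nonneg _).trans (hYb V))
  -- the torus mean of the smeared observable
  have hmean : (∫ V', (fun U => (dens G r x U - mx) * ∑ z ∈ S, wt z * (dens G r z U - m z)) (torusLift (2 * L + 1) V') ∂P) =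
      ∑ z ∈ S, wt z * ∫ V', W z (torusLift (2 * L + 1) V') ∂P := by
    have e := torusE_sum_mul r β L S wt (F := W) hWc hWb
    unfold torusE at e
    rw [smeared_eq_sum r x S wt mx m]
    exact e
  -- assemble
  calc ∑ z ∈ S, wt z * torusK3 G r β L x y z
      = ∑ z ∈ S, ∫ V, wt z * (Yc V * (W z (torusLift (2 * L + 1) V) - ∫ V', W z (torusLift (2 * L + 1) V') ∂P)) ∂P := by
        refine Finset.sum_congr rfl fun z hzS => ?_
        rw [hz z hzS, integral_const_mul]
    _ = ∫ V, ∑ z ∈ S, wt z * (Yc V * (W z (torusLift (2 * L + 1) V) - ∫ V', W z (torusLift (2 * L + 1) V') ∂P)) ∂P :=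
        (integral_finsetSum S hint).symm
    _ = ∫ V, Yc V * ((fun U => (dens G r x U - mx) * ∑ z ∈ S, wt z * (dens G r z U - m z)) (torusLift (2 * L + 1) V) -
          ∫ V', (fun U => (dens G r x U - mx) * ∑ z ∈ S, wt z * (dens G r z U - m z)) (torusLift (2 * L + 1) V') ∂P) ∂P := by
        refine integral_congr_ae (ae_of_all _ fun V => ?_)
        rw [hmean, smeared_eq_sum r x S wt mx m]
        simp only [hW]
        rw [← Finset.sum_sub_distrib, Finset.mul_sum]
        refine Finset.sum_congr rfl fun z _ => ?_
        ring

end Linear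

/-! ## §2 Sites of the inner half of the centred cube: cylinder, depth, FBL, torus mean -/

section Near

variable {G : Type} [Group G] [TopologicalSpace G] [IsTopologicalGroup G] [CompactSpace G]
  [MeasurableSpace G] [BorelSpace G] [SecondCountableTopology G] (r : LatticeRep G)

/-- **Near-site facts.**  In the radius-`M+1` cube around `z₁` (`4 ≤ M`, femto side, `4M+8 ≤ L`), a site `z₁ + w` with
`|w_j| ≤ N`, `2N ≤ M` is a cylinder observable of the cube, sits at depth `≥ M/2`, and — given FBL at `β` with constant `C₁`
and reference `pβ` — its kernel means (every exterior) and its torus mean are within `16 C₁/M⁴` of `pβ`. [folklore] -/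
theorem near_site_facts {aβ C₁ ℓ₁ β pβ : ℝ} (hC₁ : 0 ≤ C₁)
    (hF : ∀ (c : Fin 4 → ℤ) (b : ℕ), (b : ℝ) * aβ ≤ ℓ₁ → ∀ (η : LGConfig 4 G) (x : Fin 4 → ℤ),
      2 ≤ depth c b x → |kerE G r β c b η (dens G r x) - pβ| ≤ C₁ / (depth c b x : ℝ) ^ 4)
    {CA : ℝ} (hCA : ∀ (x : Fin 4 → ℤ) (U : LGConfig 4 G), |dens G r x U| ≤ CA)
    {M N L : ℕ} (hM4 : 4 ≤ M) (hNM : 2 * N ≤ M) (hb : ((2 * M + 3 : ℕ) : ℝ) * aβ ≤ ℓ₁) (h4M : 4 * M + 8 ≤ L)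
    (z₁ w : Fin 4 → ℤ) (hw : ∀ j, |w j| ≤ (N : ℤ)) :
    IsCylinder (dens G r (z₁ + w)) (cubeEdges (fun k => z₁ k - (M + 1)) (2 * M + 3)) ∧
    (M : ℝ) / 2 ≤ (depth (fun k => z₁ k - (M + 1)) (2 * M + 3) (z₁ + w) : ℝ) ∧
    (∀ η, |kerE G r β (fun k => z₁ k - (M + 1)) (2 * M + 3) η (dens G r (z₁ + w)) - pβ| ≤ 16 * C₁ / (M : ℝ) ^ 4) ∧
    |torusE G r β L (dens G r (z₁ + w)) - pβ| ≤ 16 * C₁ / (M : ℝ) ^ 4 := by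
  haveI : NeZero (2 * L + 1) := ⟨by omega⟩
  have hMpos : (0 : ℝ) < M := by exact_mod_cast (show 0 < M by omega)
  have hwj : ∀ j, |w j| + 1 ≤ (M : ℤ) := fun j => by have := hw j; omega
  have hcyl : IsCylinder (dens G r (z₁ + w)) (cubeEdges (fun k => z₁ k - (M + 1)) (2 * M + 3)) :=
    isCylinder_dens_cube_shift r z₁ w hwj
  have hdepth' : M + 2 - N ≤ depth (fun k => z₁ k - (M + 1)) (2 * M + 3) (z₁ + w) := depth_centred_shift_ge z₁ w M N hw
  have hdepth2 : 2 ≤ depth (fun k => z₁ k - (M + 1)) (2 * M + 3) (z₁ + w) := by omega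
  have hdepthR : (M : ℝ) / 2 ≤ (depth (fun k => z₁ k - (M + 1)) (2 * M + 3) (z₁ + w) : ℝ) := by
    have h1 : ((M + 2 - N : ℕ) : ℝ) ≤ (depth (fun k => z₁ k - (M + 1)) (2 * M + 3) (z₁ + w) : ℝ) := by
      exact_mod_cast hdepth'
    have h2 : M ≤ 2 * (M + 2 - N) := by omega
    have h3 : (M : ℝ) ≤ 2 * ((M + 2 - N : ℕ) : ℝ) := by exact_mod_cast h2
    linarith only [h1, h3]
  have hF' : ∀ η, |kerE G r β (fun k => z₁ k - (M + 1)) (2 * M + 3) η (dens G r (z₁ + w)) - pβ| ≤ 16 * C₁ / (M : ℝ) ^ 4 := by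
    intro η
    refine (hF (fun k => z₁ k - (M + 1)) (2 * M + 3) hb η (z₁ + w) hdepth2).trans ?_
    have hd0 : (0 : ℝ) < (depth (fun k => z₁ k - (M + 1)) (2 * M + 3) (z₁ + w) : ℝ) := by linarith only [hdepthR, hMpos]
    rw [div_le_div_iff₀ (by positivity) (by positivity)]
    have h4 : ((M : ℝ) / 2) ^ 4 ≤ (depth (fun k => z₁ k - (M + 1)) (2 * M + 3) (z₁ + w) : ℝ) ^ 4 :=
      pow_le_pow_left₀ (by positivity) hdepthR 4
    have e4 : ((M : ℝ) / 2) ^ 4 = (M : ℝ) ^ 4 / 16 := by ring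
    have h5 : (M : ℝ) ^ 4 ≤ 16 * (depth (fun k => z₁ k - (M + 1)) (2 * M + 3) (z₁ + w) : ℝ) ^ 4 := by
      rw [e4] at h4; linarith only [h4]
    have h6 := mul_le_mul_of_nonneg_left h5 hC₁
    linarith only [h6]
  refine ⟨hcyl, hdepthR, hF', ?_⟩
  exact abs_torusMean_sub_le r β (cubeEdges (fun k => z₁ k - (M + 1)) (2 * M + 3))
    (cubeEdges (fun k => z₁ k - (M + 1)) (2 * M + 3)) (continuous_dens r (z₁ + w)) (fun U => hCA _ _) hcyl
    (injOn_torusProj_cube h4M z₁) hF'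

end Near

end Summit.QuantumFields.YangMills.Cruxes.ResponseLocalisation.Smeared

end
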